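/-
Copyright (c) 2026 the pub-hodgecm-mathlib formalisation cell (harness21).  Prover seat hodgecm-mathlib-R90-CS-p03 (g3), R90-TF section S8 «ContSpec-n½» (dealer R90-CS-plan (g3);
structural finding F-A32 of census `R90/S8/CENSUS-A32-FiniteHalfOfRecord.R90-CS-p03-g3.md`, export (E-supp)): ★ FILE 2 `R90S8ChiSectionPairFinLevelSectionU3.exists_finLevelSection`
(K2E1-p11 (g4)) RE-RUN WITH ITS SUPPORT CLAUSE EXPORTED — the finite-level section `Φf` equals the Borel pair character on `B_f·Kf` and VANISHES off `B_f·Kf`.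
-/
import Summits.HodgeConjecture.HodgeConjecture.Theorems.R90S8ChiSectionPairFinLevelSectionU3   -- ★ FILE 2 p863484 (K2E1-p11 (g4)): `exists_finLevelSection`, §0 `finAdelicToAdelic_finPart_mem_borelAdelic`, `firstEntryUnit_congr`, `middleEntryUnitary_congr`
import HarnessLib

/-!
# S8 #2 road (G side) — `R90S8ChiSectionPairFinLevelSectionSupportU3` (export (E-supp)): THE FINITE-LEVEL SECTION WITH ITS SUPPORT CLAUSE — `Φf(b·k) = χ₁,f(b₀₀)·χ₂,f(b₁₁)` ON `B_f·Kf`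
# AND `Φf = 0` OFF `B_f·Kf`

Track B ∕ K2-LIT, crux h413 = `stmt-HodgeConjecture-24833`, route of record `HCCMUnconditional`; cell `hodgecm-mathlib`, R90-TF section S8 «ContSpec-n½», socket (V) ∕ ★ F5's row `hA32`
(finite half `hA32f`).  THEOREMS ONLY (no `def`, no `instance`, no `notation`, no named-fact hypothesis, no `sorry`; default heartbeats); lane `--supports stmt-HodgeConjecture-24833 --as helper`
(count-neutral).  CLOSES NO SOCKET.

WHY (structural finding F-A32, R90-CS-p03 (g3) census `CENSUS-A32-FiniteHalfOfRecord`): ★ (a-4) `K2E1ChiLocalMeanTestWeightU3` and ★ `K2E1ChiArchA32FiniteHalfOfRecordU3` pay the finite half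
`Cf(3∕2) ≠ 0` of ★ F5's `hA32` for TEST WEIGHTS at the bad places; identifying the witness section's bad-place big-cell weights as test weights requires READING the finite-level section
`Φf` OFF the identity coset — but ★ FILE 2 `exists_finLevelSection` exports only continuity, `(χ₁,χ₂)_f`-equivariance, right-`Kf`-invariance and `Φf 1 = 1`.  THIS FILE re-runs FILE 2's
construction VERBATIM (`Φf(b·k) := θ(b)` on `B_f·Kf`, `0` elsewhere, `θ(u) := χ₁((ι_f u)₀₀)·χ₂((ι_f u)₁₁)`; well defined by the conductor hypothesis `hKχ`) and exports TWO MORE CLAUSES: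
(supp-on) `Φf (b·k) = θ(b)` for `ι_f b ∈ B(𝔸)`, `k ∈ Kf`; (supp-off) `Φf u = 0` whenever `u ∉ B_f·Kf`.  With them the big-cell weight `p ↦ Φf(w₀·u(p)·g₁)` of the witness becomes a
COMPUTABLE function of the Iwasawa data of `w₀·u(p)·g₁` (next: the big-cell conjugation export (E-cell), C10-p07 FILE 1 §1 currency, and the base-point ruling of F-A32).
* **`exists_finLevelSection_with_support`** — ★ FILE 2's four clauses BYTE FOR BYTE, plus (supp-on) and (supp-off).
HONEST LABEL: HC_CM is proved only modulo the 7 printed citations (2 remaining named inputs: hLiu418 = `stmt-HodgeConjecture-24832`, h413 = `stmt-HodgeConjecture-24833`) until rung 0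
closes; REL ≠ ★ ≠ BUILT; this file asserts no named fact and closes no socket; unconditional; count-neutral.

## References
* [BorelJacquet1979] A. Borel, H. Jacquet, *Automorphic forms and automorphic representations*, Corvallis PSPM 33.1 (1979), §4.1.
* [MoeglinWaldspurger1995] C. Mœglin, J.-L. Waldspurger, *Spectral Decomposition and Eisenstein Series* (1995), I.2.17, II.1.6.
* [Casselman1973] W. Casselman, *On some results of Atkin and Lehner*, Math. Ann. 201 (1973), §1.
-/

set_option autoImplicit false
set_option linter.dupNamespace false  -- the mandated namespace `…HodgeConjecture.HodgeConjecture.R90.S8` (LEAD #1 L1) repeats the summit's segment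

noncomputable section

open NumberField Topology Filter
open Literature.NumberTheory.Automorphic Literature.NumberTheory.Automorphic.UnitaryGroup Literature.NumberTheory.GaloisRepresentations AdelicGroupData
open Literature.NumberTheory.Automorphic.Arthur2013.Leaves.TECR
open Summit.HodgeConjecture.HodgeConjecture.Cruxes.H413.K2E1CharacterEisensteinU2Defs
open Summit.HodgeConjecture.HodgeConjecture.Cruxes.H413.K2E1CharacterEisensteinU3PairDefs
open Summit.HodgeConjecture.HodgeConjecture.Cruxes.H413.K2E1ChiSectionSpaceU3PairDefs

namespace Summit.HodgeConjecture.HodgeConjecture.R90.S8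

variable (L : Type) [Field L] [NumberField L] [IsCMField L]

/-- **THE FINITE-ADELIC LEVEL SECTION WITH ITS SUPPORT CLAUSE** (★ FILE 2 `exists_finLevelSection` re-run): for an OPEN `Kf ≤ G_f = U(2,1)(𝔸_{L⁺,f})` on whose Borel elements the pair
character is trivial (`hKχ`), there is `Φf : G_f → ℂ` — `Φf(b·k) := χ₁((ι_f b)₀₀)χ₂((ι_f b)₁₁)` on `B_f·Kf`, `0` off it — CONTINUOUS, LEFT-`(χ₁,χ₂)_f`-EQUIVARIANT, RIGHT-`Kf`-INVARIANT, `Φf 1 = 1`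
(FILE 2's clauses byte for byte), AND: (supp-on) `Φf (b·k) = χ₁((ι_f b)₀₀)·χ₂((ι_f b)₁₁)` for `ι_f b ∈ B(𝔸)`, `k ∈ Kf`; (supp-off) `Φf u = 0` for every `u` off `B_f·Kf`.
[cite: BorelJacquet1979, §4.1] [cite: MoeglinWaldspurger1995, I.2.17] [cite: Casselman1973, §1] -/
theorem exists_finLevelSection_with_support (χ₁ : HeckeCharacter L) (χ₂ : ↥(TorusDict.torus (IsCMField.complexConj L)) →ₜ* ℂˣ)
    (Kf : Subgroup ↥(finAdelic (↥(maximalRealSubfield L)) L (IsCMField.complexConj L) 3 ((StdForm.antidiagonal 3).over L)))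
    (hKo : IsOpen ((Kf : Subgroup ↥(finAdelic (↥(maximalRealSubfield L)) L (IsCMField.complexConj L) 3 ((StdForm.antidiagonal 3).over L))) : Set ↥(finAdelic (↥(maximalRealSubfield L)) L (IsCMField.complexConj L) 3 ((StdForm.antidiagonal 3).over L))))
    (hKχ : ∀ k ∈ Kf, ∀ (hk : finAdelicToAdelic (↥(maximalRealSubfield L)) L (IsCMField.complexConj L) 3 ((StdForm.antidiagonal 3).over L) k ∈ borelAdelic (↥(maximalRealSubfield L)) L (IsCMField.complexConj L) 3),
      ((χ₁ (firstEntryUnit hk) : ℂˣ) : ℂ) * ((χ₂ (middleEntryUnitary hk) : ℂˣ) : ℂ) = 1) :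
    ∃ Φf : ↥(finAdelic (↥(maximalRealSubfield L)) L (IsCMField.complexConj L) 3 ((StdForm.antidiagonal 3).over L)) → ℂ,
      Continuous Φf ∧
      (∀ (b : (quasiSplit (↥(maximalRealSubfield L)) L (IsCMField.complexConj L) 3).Adelic) (hb : b ∈ borelAdelic (↥(maximalRealSubfield L)) L (IsCMField.complexConj L) 3)
          (u : ↥(finAdelic (↥(maximalRealSubfield L)) L (IsCMField.complexConj L) 3 ((StdForm.antidiagonal 3).over L))),
        Φf (finPart (↥(maximalRealSubfield L)) L (IsCMField.complexConj L) 3 ((StdForm.antidiagonal 3).over L) b * u) =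
          (((χ₁ (firstEntryUnit (finAdelicToAdelic_finPart_mem_borelAdelic L hb)) : ℂˣ) : ℂ) * ((χ₂ (middleEntryUnitary (finAdelicToAdelic_finPart_mem_borelAdelic L hb)) : ℂˣ) : ℂ)) * Φf u) ∧
      (∀ u, ∀ k ∈ Kf, Φf (u * k) = Φf u) ∧ Φf 1 = 1 ∧
      (∀ (b k : ↥(finAdelic (↥(maximalRealSubfield L)) L (IsCMField.complexConj L) 3 ((StdForm.antidiagonal 3).over L)))
          (hb : finAdelicToAdelic (↥(maximalRealSubfield L)) L (IsCMField.complexConj L) 3 ((StdForm.antidiagonal 3).over L) b ∈ borelAdelic (↥(maximalRealSubfield L)) L (IsCMField.complexConj L) 3),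
        k ∈ Kf → Φf (b * k) = ((χ₁ (firstEntryUnit hb) : ℂˣ) : ℂ) * ((χ₂ (middleEntryUnitary hb) : ℂˣ) : ℂ)) ∧
      (∀ u, (∀ (b k : ↥(finAdelic (↥(maximalRealSubfield L)) L (IsCMField.complexConj L) 3 ((StdForm.antidiagonal 3).over L))),
          finAdelicToAdelic (↥(maximalRealSubfield L)) L (IsCMField.complexConj L) 3 ((StdForm.antidiagonal 3).over L) b ∈ borelAdelic (↥(maximalRealSubfield L)) L (IsCMField.complexConj L) 3 →
            k ∈ Kf → u ≠ b * k) → Φf u = 0) := by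
  classical
  -- the finite Borel character `θ` (as a function on `G_f`, meaningful on `B_f := ι_f⁻¹ B(𝔸)`)
  set ιf := finAdelicToAdelic (↥(maximalRealSubfield L)) L (IsCMField.complexConj L) 3 ((StdForm.antidiagonal 3).over L) with hιf
  set θ : ↥(finAdelic (↥(maximalRealSubfield L)) L (IsCMField.complexConj L) 3 ((StdForm.antidiagonal 3).over L)) → ℂ := fun u =>
    if hu : ιf u ∈ borelAdelic (↥(maximalRealSubfield L)) L (IsCMField.complexConj L) 3 then ((χ₁ (firstEntryUnit hu) : ℂˣ) : ℂ) * ((χ₂ (middleEntryUnitary hu) : ℂˣ) : ℂ) else 0 with hθ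
  have hθ_of : ∀ {u} (hu : ιf u ∈ borelAdelic (↥(maximalRealSubfield L)) L (IsCMField.complexConj L) 3),
      θ u = ((χ₁ (firstEntryUnit hu) : ℂˣ) : ℂ) * ((χ₂ (middleEntryUnitary hu) : ℂˣ) : ℂ) := fun hu => by
    simp only [hθ, dif_pos hu]
  -- `θ` is multiplicative on `B_f` and `θ(1) = 1`
  have hθ_mul : ∀ {u v} (hu : ιf u ∈ borelAdelic (↥(maximalRealSubfield L)) L (IsCMField.complexConj L) 3) (hv : ιf v ∈ borelAdelic (↥(maximalRealSubfield L)) L (IsCMField.complexConj L) 3),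
      θ (u * v) = θ u * θ v := fun {u v} hu hv => by
    have huv : ιf (u * v) ∈ borelAdelic (↥(maximalRealSubfield L)) L (IsCMField.complexConj L) 3 := by rw [map_mul]; exact Subgroup.mul_mem _ hu hv
    rw [hθ_of huv, hθ_of hu, hθ_of hv, firstEntryUnit_congr L (map_mul ιf u v) huv (Subgroup.mul_mem _ hu hv), middleEntryUnitary_congr L (map_mul ιf u v) huv (Subgroup.mul_mem _ hu hv),
      firstEntryUnit_mul hu hv, middleEntryUnitary_mul hu hv, map_mul, map_mul, Units.val_mul, Units.val_mul]
    ring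
  have h1B : ιf 1 ∈ borelAdelic (↥(maximalRealSubfield L)) L (IsCMField.complexConj L) 3 := by rw [map_one]; exact Subgroup.one_mem _
  have hθ_one : θ 1 = 1 := by
    rw [hθ_of h1B, firstEntryUnit_congr L (map_one ιf) h1B (Subgroup.one_mem _), middleEntryUnitary_congr L (map_one ιf) h1B (Subgroup.one_mem _), firstEntryUnit_one, middleEntryUnitary_one,
      map_one, map_one, Units.val_one, one_mul]
  -- well-definedness of `θ(b)` on the coset space `B_f·Kf / Kf`: `b k = b′ k′ ⇒ θ b = θ b′`
  have hwd : ∀ {b b' k k'} (hb : ιf b ∈ borelAdelic (↥(maximalRealSubfield L)) L (IsCMField.complexConj L) 3) (hb' : ιf b' ∈ borelAdelic (↥(maximalRealSubfield L)) L (IsCMField.complexConj L) 3),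
      k ∈ Kf → k' ∈ Kf → b * k = b' * k' → θ b = θ b' := fun {b b' k k'} hb hb' hk hk' heq => by
    -- `m := b′⁻¹ b = k′ k⁻¹ ∈ B_f ∩ Kf`, `θ m = 1`, `b = b′ m`
    have hm : b'⁻¹ * b = k' * k⁻¹ := by
      rw [inv_mul_eq_iff_eq_mul, ← mul_assoc, ← heq, mul_assoc, mul_inv_cancel, mul_one]
    have hmK : b'⁻¹ * b ∈ Kf := by rw [hm]; exact Kf.mul_mem hk' (Kf.inv_mem hk)
    have hmB : ιf (b'⁻¹ * b) ∈ borelAdelic (↥(maximalRealSubfield L)) L (IsCMField.complexConj L) 3 := by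
      rw [map_mul, map_inv]; exact Subgroup.mul_mem _ (Subgroup.inv_mem _ hb') hb
    have hθm : θ (b'⁻¹ * b) = 1 := by rw [hθ_of hmB]; exact hKχ _ hmK hmB
    calc θ b = θ (b' * (b'⁻¹ * b)) := by rw [mul_inv_cancel_left]
      _ = θ b' := by rw [hθ_mul hb' hmB, hθm, mul_one]
  -- the section
  set Φf : ↥(finAdelic (↥(maximalRealSubfield L)) L (IsCMField.complexConj L) 3 ((StdForm.antidiagonal 3).over L)) → ℂ := fun u =>
    if h : ∃ b k, ιf b ∈ borelAdelic (↥(maximalRealSubfield L)) L (IsCMField.complexConj L) 3 ∧ k ∈ Kf ∧ u = b * k then θ h.choose else 0 with hΦf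
  -- its value on `B_f·Kf` and off it
  have hval : ∀ {u b k} (hb : ιf b ∈ borelAdelic (↥(maximalRealSubfield L)) L (IsCMField.complexConj L) 3), k ∈ Kf → u = b * k → Φf u = θ b := fun {u b k} hb hk hu => by
    have h : ∃ b k, ιf b ∈ borelAdelic (↥(maximalRealSubfield L)) L (IsCMField.complexConj L) 3 ∧ k ∈ Kf ∧ u = b * k := ⟨b, k, hb, hk, hu⟩
    have hΦu : Φf u = θ h.choose := by simp only [hΦf, dif_pos h]
    obtain ⟨k₀, hb₀, hk₀, hu₀⟩ := h.choose_spec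
    rw [hΦu]
    exact hwd hb₀ hb hk₀ hk (hu₀.symm.trans hu)
  have hval0 : ∀ {u}, (¬ ∃ b k, ιf b ∈ borelAdelic (↥(maximalRealSubfield L)) L (IsCMField.complexConj L) 3 ∧ k ∈ Kf ∧ u = b * k) → Φf u = 0 := fun h => by
    simp only [hΦf, dif_neg h]
  -- right `Kf`-invariance
  have hK : ∀ u, ∀ k ∈ Kf, Φf (u * k) = Φf u := by
    intro u k hk
    by_cases h : ∃ b k', ιf b ∈ borelAdelic (↥(maximalRealSubfield L)) L (IsCMField.complexConj L) 3 ∧ k' ∈ Kf ∧ u = b * k'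
    · obtain ⟨b, k', hb, hk', rfl⟩ := h
      rw [hval hb hk' rfl, hval hb (Kf.mul_mem hk' hk) (mul_assoc b k' k)]
    · have h' : ¬ ∃ b k', ιf b ∈ borelAdelic (↥(maximalRealSubfield L)) L (IsCMField.complexConj L) 3 ∧ k' ∈ Kf ∧ u * k = b * k' := by
        rintro ⟨b, k', hb, hk', hbk⟩
        exact h ⟨b, k' * k⁻¹, hb, Kf.mul_mem hk' (Kf.inv_mem hk), by rw [← mul_assoc, ← hbk, mul_inv_cancel_right]⟩
      rw [hval0 h, hval0 h']
  refine ⟨Φf, ?_, fun b hb u => ?_, hK, ?_, fun b k hb hk => ?_, fun u hu => hval0 ?_⟩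
  · -- continuity: `Φf` is locally constant (constant on the open cosets `u·Kf`)
    refine IsLocallyConstant.continuous ((IsLocallyConstant.iff_eventually_eq Φf).2 fun u => ?_)
    have hopen : IsOpen ((fun k => u * k) '' ((Kf : Subgroup ↥(finAdelic (↥(maximalRealSubfield L)) L (IsCMField.complexConj L) 3 ((StdForm.antidiagonal 3).over L))) :
        Set ↥(finAdelic (↥(maximalRealSubfield L)) L (IsCMField.complexConj L) 3 ((StdForm.antidiagonal 3).over L)))) := isOpenMap_mul_left u _ hKo
    filter_upwards [hopen.mem_nhds ⟨1, Kf.one_mem, mul_one u⟩] with y hy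
    obtain ⟨k, hk, rfl⟩ := hy
    exact hK u k hk
  · -- left equivariance under `b_f` for an adelic Borel `b`
    have hβ : ιf (finPart (↥(maximalRealSubfield L)) L (IsCMField.complexConj L) 3 ((StdForm.antidiagonal 3).over L) b) ∈ borelAdelic (↥(maximalRealSubfield L)) L (IsCMField.complexConj L) 3 :=
      finAdelicToAdelic_finPart_mem_borelAdelic L hb
    by_cases h : ∃ b₁ k, ιf b₁ ∈ borelAdelic (↥(maximalRealSubfield L)) L (IsCMField.complexConj L) 3 ∧ k ∈ Kf ∧ u = b₁ * k
    · obtain ⟨b₁, k, hb₁, hk, rfl⟩ := h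
      have hβb₁ : ιf (finPart (↥(maximalRealSubfield L)) L (IsCMField.complexConj L) 3 ((StdForm.antidiagonal 3).over L) b * b₁) ∈ borelAdelic (↥(maximalRealSubfield L)) L (IsCMField.complexConj L) 3 := by
        rw [map_mul]; exact Subgroup.mul_mem _ hβ hb₁
      rw [hval hb₁ hk rfl, hval hβb₁ hk (mul_assoc _ b₁ k).symm, hθ_mul hβ hb₁, hθ_of hβ]
    · have h' : ¬ ∃ b₁ k, ιf b₁ ∈ borelAdelic (↥(maximalRealSubfield L)) L (IsCMField.complexConj L) 3 ∧ k ∈ Kf ∧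
          finPart (↥(maximalRealSubfield L)) L (IsCMField.complexConj L) 3 ((StdForm.antidiagonal 3).over L) b * u = b₁ * k := by
        rintro ⟨b₁, k, hb₁, hk, hbk⟩
        refine h ⟨(finPart (↥(maximalRealSubfield L)) L (IsCMField.complexConj L) 3 ((StdForm.antidiagonal 3).over L) b)⁻¹ * b₁, k, ?_, hk, ?_⟩
        · rw [map_mul, map_inv]; exact Subgroup.mul_mem _ (Subgroup.inv_mem _ hβ) hb₁
        · rw [mul_assoc, ← hbk, inv_mul_cancel_left]
      rw [hval0 h, hval0 h', mul_zero]
  · -- normalisation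
    rw [hval h1B Kf.one_mem (mul_one _).symm, hθ_one]
  · -- the value on the support `B_f·Kf`
    rw [hval hb hk rfl, hθ_of hb]
  · -- vanishing off `B_f·Kf`
    rintro ⟨b, k, hb, hk, hu'⟩
    exact hu b k hb hk hu'

end Summit.HodgeConjecture.HodgeConjecture.R90.S8

end
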